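import Literature.NumberTheory.Rogawski1990.GlobalAPacketMembership           -- ★ `OneDimAutRepH` currency (`TorusDict.torus ∕ IsAutomorphic ∕ pullback`), `splitWitness`, `UnitaryGroup.localSplitEquiv`, `PlacesOver`
import Literature.NumberTheory.Rogawski1990.CMLocalAPacketMembers             -- ★ `Representation.parabolicIndGL`, `Zelevinsky1980.maxParabolicLeviChar ∕ lastBlockLabel` (split members, N-generic), `cmSplitEquiv` pattern
import Literature.NumberTheory.Automorphic.UnitaryGroupBorelInduction           -- ★ `UnitaryGroup.cmPrincipalSeries L N v`, `UnitaryGroup.torusCharPair` (N-generic)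
import Literature.NumberTheory.Automorphic.LocalUnitaryIntegralLevel           -- ★ `UnitaryGroup.cmLocalIntegralLevel` (`U(H)(𝒪_v)`)
import Literature.NumberTheory.Automorphic.HeckeEigencharacterPackage          -- ★ `IrrClass.IsSpherical`
import Literature.NumberTheory.Automorphic.UnitaryGroupCohomologicalForms      -- ★ `DiscreteAutomorphicRep`, `finRep`, `inclPlace`, `localPiEquiv` (the discrete-ρ reading)
import HarnessLib

/-!
# R90-TF · S5 «Ch. 13.3» — THE «ρ(θ) OF RECORD» DEFINITIONS: `R90.S5.IsThetaMemberAt`, `R90.S5.IsThetaOfRecord`, `R90.S5.IsThetaOfRecordDiscrete`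
# (`Theorems/R90S5ThetaOfRecordDefs.lean`; seat R90-C133-p03 (g0); R90-C133-plan (g0) DEAL #11 2026-09-04T16:11:48Z, rulings (θ-1)(θ-2)(θ-3); JQ-S7-3: S5 owns the definition)

Cell `hodgecm-mathlib`, crux H413 (`stmt-HodgeConjecture-24833`), route of record `HCCMUnconditional`; programme R90-TF, section S5.  DEFINITION lane
(`--supports stmt-HodgeConjecture-24833 --as helper`): three `def … : Prop` WITH BODIES (predicates with parameters; RELATIONAL, CHOICE-FREE, KIT-FREE — no
`Classical.choose`, no «else junk», no ∀-over-kits) + `Iff.rfl` unfoldings; no instance, no notation, no `sorry`, no theorem with content.  Census of record: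
`R90/S5/R90-C133-p03/CENSUS-isThetaOfRecord.md` 076d549046eb5262 (DEAL #8).  Consumers (import this ★ file; L9: defs DOWN): S5 C ED. 4 law (T′) `stub_R90_S5_oneDim_notTheta`,
S7's `nH` reading «`n(ρ) = ½ ⟺ IsThetaOfRecord`» (EXPORT-EDGES v3), S8 `Pinning.ov_cm`, S10's H-family `d : J → DiscreteClass (cmDatum L 2 Φ₂) μH` (through `IsThetaOfRecordDiscrete`).

THE PRINT.  `C = U(1)³`, `θ = θ₁ ⊗ θ₂ ⊗ θ₃`; `ρ(θ) := ρ(θ₁ ⊗ θ₃) ⊗ θ₂` on `H = U(2) × U(1)` [§12.1 p. 170], where `ρ(θ₁ ⊗ θ₃)` is the two-element L-packet of `U(2)`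
attached to the character `θ₁ ⊗ θ₃` of its endoscopic `U(1) × U(1)` [§11.1 p. 162: «functoriality with respect to `ξ_H : ᴸH → ᴸG`»; global: «if θ is a regular character of `H\𝐇`,
then `ρ(θ) = ⊗ρ(θ_v)` is a cuspidal L-packet …; if θ is singular, `ρ(θ)` does not occur in the discrete spectrum»; Prop. 11.1.1 (a): a discrete L-packet of `U(2)` has more than one
element iff it is `ρ(θ)`, θ REGULAR, i.e. `θ₁ ≠ θ₃`].  THE E.V.P. STRING [Prop. 11.4.1 (a) p. 166]: «If `ρ = ρ(θ)`, then `ρ̃ = i_{G̃}(μ(θ))`», `μ(θ) = (θ̃₁μ⁻¹, θ̃₃μ⁻¹)`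
[§11.2 p. 164; §12.1 p. 171: `μ(θ) = (θ̃₁μ⁻¹, θ̃₂, θ̃₃μ⁻¹)` — the twist by Rogawski's auxiliary `μ` (`μ|𝕀_{L⁺} = ω_{L/L⁺}`, §4.8) sits in the U(2)-block], `θ̃(a) = θ(a/ā)`: at a place `v`
of `L⁺` SPLIT in `L` (`v = w w̄`, `U(Φ₂)(L⁺_v) ≅ GL₂(L_w)` by the `w`-projection [§4.13 p. 62]) the member of `ρ(θ₁ ⊗ θ₃)_v` is the unitary principal series
`i_{GL₂(L_w)}((θ̃₁μ⁻¹)_w, (θ̃₃μ⁻¹)_w)`; at a NON-SPLIT `v` unramified for `θ₁, θ₃, μ` the local characters `θ̃ᵢ,w` are TRIVIAL (Hilbert 90 on units) and `ρ(θ_v) = JH(i_{U(Φ₂)}(μ_v⁻¹))`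
[Prop. 11.1.1 (c): θ_v locally singular] — so the non-split places carry no θ-information and the string MUST be read at ALL cofinite places, split included (census (v), B5′).

THE DEFINITIONS (ruling (θ-2): relational, choice-free; currency (θ-1) = ★ `OneDimAutRepH`'s: `θ₁ θ₃ : ↥(TorusDict.torus c̄) →ₜ* ℂˣ` automorphic, base changes ★ `TorusDict.pullback`).
* `IsThetaMemberAt μω θ₁ θ₃ h₁ h₃ v c` — «the class `c` of `U(Φ₂)(L⁺_v)` is the `v`-member of `ρ(θ₁ ⊗ θ₃)` in the record's reading»:
  SPLIT `v` (fixed witness `w = splitWitness v hs`, as ★ D6 `IsXiLocalFamily`; pattern of ★ `cmSplitPacket`): `c` is a CONSTITUENT of the normalised Borel induction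
  ★ `Representation.parabolicIndGL (L_w) (lastBlockLabel 2) (𝟙.twist (maxParabolicLeviChar _ 2 ν₁ ν₃))` pulled back along ★ `UnitaryGroup.localSplitEquiv`, with
  `νᵢ := ((TorusDict.pullback θᵢ) · μω⁻¹).localComponent w` (the planner's bytes (θ-2) verbatim; «constituent of» rather than «=» so that no irreducibility lemma at N = 2 is on the path —
  the induction IS irreducible for unitary `νᵢ`, ★ NF `parabolicIndGL_detChar_unitary_isIrreducible`, same truth);
  NON-SPLIT `v`: `c` is a `U(Φ₂)(𝒪_v)`-SPHERICAL constituent of the principal series ★ `cmPrincipalSeries L 2 v (torusCharPair … 0 χ₁ 1)` with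
  `χ₁ := ((TorusDict.pullback θ₁) · μω⁻¹).semilocalComponent L v` (print's `θ̃₁μ⁻¹` on the first diagonal entry; at the finitely many non-split `v` where `θ_v` is locally regular
  `ρ(θ_v)` is supercuspidal [Prop. 11.1.1 (e)] and the clause fails — absorbed by `∀ᶠ v in cofinite` below).
  CONVENTION NOTE: the tree's `TorusDict.pullback θ = θ ∘ (z ↦ z̄/z)` is the INVERSE of print's `θ̃` (cf. ★ `OneDimAutRepH.locη = (bcη_w)⁻¹`); since `θ ↦ θ⁻¹` is a bijection of
  regular pairs, the ∃-predicate `IsThetaOfRecord` below is insensitive to this choice; `μω` enters with exponent `−1` in both clauses exactly as in print's `μ(θ)`.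
* `IsThetaOfRecord μω π₂` — «the family `π₂ = (π₂,v)_v` of local classes of `U(Φ₂)` IS OF THE FORM `ρ(θ)`, θ REGULAR»: `∃ θ₁ θ₃` automorphic, `θ₁ ≠ θ₃` (GLOBAL inequality), and
  `∀ᶠ v in cofinite, IsThetaMemberAt μω θ₁ θ₃ _ _ v (π₂ v)` — over ALL finite places of `L⁺`.
* `IsThetaOfRecordDiscrete μω ρ₁` — the reading for a DISCRETE automorphic `ρ₁` of `U(Φ₂)` (S10's `d j`): some family of `v`-constituents of `ρ₁` (★ D6 constituent currency:
  `IrrClass.comap (localPiEquiv v) c` is a constituent of `ρ₁.finRep.smoothPart|_{U(Φ₂)(L⁺_v)}`) `IsThetaOfRecord`.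
HONEST LABEL: DEFINITIONS ONLY — nothing is asserted about any `ρ`; the laws (T′) «a one-dimensional `η ∘ det` is never `IsThetaOfRecord`» [Prop. 11.1.1 (a); 11.4.1 (a) vs (b)] and
KD5-H♭ «`¬ IsThetaOfRecord ⇒ n(ρ) = 1`» [Thm. 11.5.1 (c)] are the consumers' sockets∕theorems, not stated here.  REL ≠ ★ ≠ BUILT; HC_CM is proved only modulo the 7 printed citations
(2 remaining named inputs: hLiu418 = stmt-HodgeConjecture-24832, h413 = stmt-HodgeConjecture-24833) until rung 0 closes.

## References
* [Rogawski1990] J. D. Rogawski, *Automorphic Representations of Unitary Groups in Three Variables*, Ann. of Math. Stud. 123 (1990): §11.1 pp. 161–163 (Prop. 11.1.1), §11.2 p. 164,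
  §11.4 pp. 165–166 (Prop. 11.4.1), §11.5 Thm. 11.5.1 p. 167, §12.1 pp. 170–172, §13.1 pp. 198–199, §4.8 p. 51, §4.13 p. 62.
* [LabesseLanglands1979] J.-P. Labesse, R. P. Langlands, *L-indistinguishability for SL(2)*, Canad. J. Math. 31 (1979) (the book's [LL]; cited through the book).
* [Zelevinsky1980] A. Zelevinsky, *Induced representations of reductive 𝔭-adic groups II*, Ann. Sci. ÉNS 13 (1980), §3.2, Thm. 4.2.
-/

set_option autoImplicit false
-- the mandated namespace repeats the single-problem summit's segment (`HodgeConjecture.HodgeConjecture`)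
set_option linter.dupNamespace false

noncomputable section

open NumberField IsDedekindDomain MeasureTheory Filter
open scoped Matrix
open Literature.NumberTheory.Rogawski1990 Literature.NumberTheory.GaloisRepresentations
open Literature.NumberTheory.Automorphic Literature.NumberTheory.Automorphic.UnitaryGroup
open Literature.NumberTheory.Automorphic.Arthur2013.Leaves.TECR

namespace Summit.HodgeConjecture.HodgeConjecture.R90.S5

variable (L : Type) [Field L] [NumberField L] [IsCMField L]

/-! ## §1 The member predicate at one place -/

/-- **`IsThetaMemberAt μω θ₁ θ₃ h₁ h₃ v c` — the class `c` of `U(Φ₂)(L⁺_v)` is the `v`-MEMBER OF `ρ(θ₁ ⊗ θ₃)` in the record's reading** (`Φ₂` = the antidiagonal form of rank 2,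
spelled as in S5 file D ∕ E1; `θ₁, θ₃` automorphic characters of `U(1)` in ★ `OneDimAutRepH`'s currency; `μω` Rogawski's auxiliary Hecke character).  SPLIT `v` (fixed witness ★
`splitWitness v hs`): `c` is a constituent of `i_{GL₂(L_w)}(ν₁, ν₃)` — ★ `Representation.parabolicIndGL` from the Borel (= the `(1,1)`-parabolic ★ `lastBlockLabel 2`) of the character
★ `maxParabolicLeviChar _ 2 ν₁ ν₃`, `νᵢ = ((pullback θᵢ) · μω⁻¹)_w` — pulled back along the `w`-projection ★ `UnitaryGroup.localSplitEquiv` [Prop. 11.4.1 (a): `ρ̃(θ) = i_{G̃}(θ̃₁μ⁻¹, θ̃₃μ⁻¹)`;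
§4.13].  NON-SPLIT `v`: `c` is a `U(Φ₂)(𝒪_v)`-spherical constituent of ★ `cmPrincipalSeries L 2 v (torusCharPair … 0 χ₁ 1)`, `χ₁ = ((pullback θ₁) · μω⁻¹)_v` on the first diagonal
entry [Prop. 11.1.1 (c): `ρ(θ_v) = JH(i_G(θ̃μ⁻¹))` for locally singular `θ_v`, which is the case at all but finitely many non-split `v`].
[cite: Rogawski1990, §11.4 Prop. 11.4.1 (a) p. 166; §11.1 Prop. 11.1.1 (c) p. 163; §12.1 pp. 170–171; §4.13 p. 62] -/
def IsThetaMemberAt (μω : HeckeCharacter L)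
    (θ₁ θ₃ : ↥(TorusDict.torus (IsCMField.complexConj L)) →ₜ* ℂˣ)
    (h₁ : TorusDict.IsAutomorphic (IsCMField.complexConj L) θ₁) (h₃ : TorusDict.IsAutomorphic (IsCMField.complexConj L) θ₃)
    (v : HeightOneSpectrum (𝓞 ↥(maximalRealSubfield L)))
    (c : IrrClass ((UnitaryGroup.cmDatum L 2 (Matrix.of fun i j : Fin 2 => if i.val + j.val + 1 = 2 then (1 : L) else 0)).Local v)) : Prop :=
  -- SPLIT `v`: the principal series `i_{GL₂(L_w)}(ν₁, ν₃)` at the fixed witness `w`, read on `U(Φ₂)(L⁺_v)` along the `w`-projection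
  (∀ hs : ∃ w : PlacesOver L v, IsCMField.complexConj L • w.1 ≠ w.1,
    ∀ [LocallyCompactSpace (standardParabolicGL ((splitWitness v hs).1.adicCompletion L) (Zelevinsky1980.lastBlockLabel 2))],
    (IrrClass.comap
        (UnitaryGroup.localSplitEquiv (IsCMField.complexConj L) (Matrix.of fun i j : Fin 2 => if i.val + j.val + 1 = 2 then (1 : L) else 0)
          (IsCMField.complexConj_ne_one L)
          (by ext i j; fin_cases i <;> fin_cases j <;> simp [Matrix.transpose_apply, Matrix.map_apply])
          (splitWitness v hs) (splitWitness_spec v hs)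
          (by
            have hdet : (Matrix.of fun i j : Fin 2 => if i.val + j.val + 1 = 2 then (1 : L) else 0).det = -1 := by
              simp [Matrix.det_fin_two]
            exact UnitaryGroup.isUnit_placeForm_of_isUnit_det (hdet ▸ isUnit_one.neg) (splitWitness v hs).1)).symm c).IsConstituentOf
      (Representation.parabolicIndGL ((splitWitness v hs).1.adicCompletion L) (Zelevinsky1980.lastBlockLabel 2)
        ((Representation.trivial ℂ (Π a : Bool, GL {i : Fin 2 // Zelevinsky1980.lastBlockLabel 2 i = a} ((splitWitness v hs).1.adicCompletion L)) ℂ).twist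
          (Zelevinsky1980.maxParabolicLeviChar ((splitWitness v hs).1.adicCompletion L) 2
            (((TorusDict.pullback (IsCMField.complexConj L) (Algebra.IsQuadraticExtension.finrank_eq_two _ L) (IsCMField.complexConj_ne_one (K := L)) θ₁ h₁) *
                μω⁻¹).localComponent (splitWitness v hs).1)
            (((TorusDict.pullback (IsCMField.complexConj L) (Algebra.IsQuadraticExtension.finrank_eq_two _ L) (IsCMField.complexConj_ne_one (K := L)) θ₃ h₃) *
                μω⁻¹).localComponent (splitWitness v hs).1))))) ∧
  -- NON-SPLIT `v`: a `U(Φ₂)(𝒪_v)`-spherical constituent of `i_{U(Φ₂)}(χ₁)`, `χ₁ = (θ̃₁μ⁻¹)_v` on the first diagonal entry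
  ((∀ w : PlacesOver L v, IsCMField.complexConj L • w.1 = w.1) →
    c.IsConstituentOf (UnitaryGroup.cmPrincipalSeries L 2 v
      (UnitaryGroup.torusCharPair (conjLocal L (IsCMField.complexConj L) v) (cmLocalForm L 2 v) (cmLocalForm_eq_over L 2 v) 0
        (((TorusDict.pullback (IsCMField.complexConj L) (Algebra.IsQuadraticExtension.finrank_eq_two _ L) (IsCMField.complexConj_ne_one (K := L)) θ₁ h₁) *
            μω⁻¹).semilocalComponent L v) 1)) ∧
    c.IsSpherical (UnitaryGroup.cmLocalIntegralLevel L 2 (Matrix.of fun i j : Fin 2 => if i.val + j.val + 1 = 2 then (1 : L) else 0) v))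

/-- Unfolding `IsThetaMemberAt` (`Iff.rfl`). [cite: Rogawski1990, §11.4 Prop. 11.4.1 (a) p. 166; §11.1 Prop. 11.1.1 (c) p. 163] -/
theorem isThetaMemberAt_iff (μω : HeckeCharacter L)
    (θ₁ θ₃ : ↥(TorusDict.torus (IsCMField.complexConj L)) →ₜ* ℂˣ)
    (h₁ : TorusDict.IsAutomorphic (IsCMField.complexConj L) θ₁) (h₃ : TorusDict.IsAutomorphic (IsCMField.complexConj L) θ₃)
    (v : HeightOneSpectrum (𝓞 ↥(maximalRealSubfield L)))
    (c : IrrClass ((UnitaryGroup.cmDatum L 2 (Matrix.of fun i j : Fin 2 => if i.val + j.val + 1 = 2 then (1 : L) else 0)).Local v)) :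
    IsThetaMemberAt L μω θ₁ θ₃ h₁ h₃ v c ↔
      (∀ hs : ∃ w : PlacesOver L v, IsCMField.complexConj L • w.1 ≠ w.1,
        ∀ [LocallyCompactSpace (standardParabolicGL ((splitWitness v hs).1.adicCompletion L) (Zelevinsky1980.lastBlockLabel 2))],
        (IrrClass.comap
            (UnitaryGroup.localSplitEquiv (IsCMField.complexConj L) (Matrix.of fun i j : Fin 2 => if i.val + j.val + 1 = 2 then (1 : L) else 0)
              (IsCMField.complexConj_ne_one L)
              (by ext i j; fin_cases i <;> fin_cases j <;> simp [Matrix.transpose_apply, Matrix.map_apply])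
              (splitWitness v hs) (splitWitness_spec v hs)
              (by
                have hdet : (Matrix.of fun i j : Fin 2 => if i.val + j.val + 1 = 2 then (1 : L) else 0).det = -1 := by
                  simp [Matrix.det_fin_two]
                exact UnitaryGroup.isUnit_placeForm_of_isUnit_det (hdet ▸ isUnit_one.neg) (splitWitness v hs).1)).symm c).IsConstituentOf
          (Representation.parabolicIndGL ((splitWitness v hs).1.adicCompletion L) (Zelevinsky1980.lastBlockLabel 2)
            ((Representation.trivial ℂ (Π a : Bool, GL {i : Fin 2 // Zelevinsky1980.lastBlockLabel 2 i = a} ((splitWitness v hs).1.adicCompletion L)) ℂ).twist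
              (Zelevinsky1980.maxParabolicLeviChar ((splitWitness v hs).1.adicCompletion L) 2
                (((TorusDict.pullback (IsCMField.complexConj L) (Algebra.IsQuadraticExtension.finrank_eq_two _ L) (IsCMField.complexConj_ne_one (K := L)) θ₁ h₁) *
                    μω⁻¹).localComponent (splitWitness v hs).1)
                (((TorusDict.pullback (IsCMField.complexConj L) (Algebra.IsQuadraticExtension.finrank_eq_two _ L) (IsCMField.complexConj_ne_one (K := L)) θ₃ h₃) *
                    μω⁻¹).localComponent (splitWitness v hs).1))))) ∧
      ((∀ w : PlacesOver L v, IsCMField.complexConj L • w.1 = w.1) →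
        c.IsConstituentOf (UnitaryGroup.cmPrincipalSeries L 2 v
          (UnitaryGroup.torusCharPair (conjLocal L (IsCMField.complexConj L) v) (cmLocalForm L 2 v) (cmLocalForm_eq_over L 2 v) 0
            (((TorusDict.pullback (IsCMField.complexConj L) (Algebra.IsQuadraticExtension.finrank_eq_two _ L) (IsCMField.complexConj_ne_one (K := L)) θ₁ h₁) *
                μω⁻¹).semilocalComponent L v) 1)) ∧
        c.IsSpherical (UnitaryGroup.cmLocalIntegralLevel L 2 (Matrix.of fun i j : Fin 2 => if i.val + j.val + 1 = 2 then (1 : L) else 0) v)) :=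
  Iff.rfl

/-! ## §2 «π₂ is of the form ρ(θ), θ regular» for a family of local classes of `U(Φ₂)` -/

/-- **`IsThetaOfRecord μω π₂` — THE FAMILY `π₂ = (π₂,v)_v` OF LOCAL CLASSES OF `U(Φ₂)` IS OF THE FORM `ρ(θ)` WITH `θ = θ₁ ⊗ θ₃` REGULAR**: there are automorphic characters
`θ₁ ≠ θ₃` of `U(1)` (★ `OneDimAutRepH` currency; the inequality is GLOBAL — locally they agree at almost every non-split place) such that at ALL BUT FINITELY MANY finite places `v`
of `L⁺` — SPLIT PLACES INCLUDED (census (v): the non-split places carry no θ-information) — `π₂,v` is the `v`-member of `ρ(θ₁ ⊗ θ₃)` (`IsThetaMemberAt`).  Print: the discrete L-packets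
of `U(2)` with two elements are exactly the `ρ(θ)`, θ regular [Prop. 11.1.1 (a)], and `ρ(θ)` is pinned by its e.v.p. string `ψ_G(ρ(θ)) = i_{G̃}(θ̃₁μ⁻¹, θ̃₃μ⁻¹)` [Prop. 11.4.1 (a); Thm. 11.5.1 (a)
injectivity; SMO for Hecke characters].  Relational, choice-free, kit-free (ruling (θ-2)).
[cite: Rogawski1990, §11.1 Prop. 11.1.1 (a) p. 162; §11.4 Prop. 11.4.1 (a) p. 166; §11.5 Thm. 11.5.1 (a) p. 167; §12.1 p. 170] -/
def IsThetaOfRecord (μω : HeckeCharacter L)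
    (π₂ : ∀ v : HeightOneSpectrum (𝓞 ↥(maximalRealSubfield L)),
      IrrClass ((UnitaryGroup.cmDatum L 2 (Matrix.of fun i j : Fin 2 => if i.val + j.val + 1 = 2 then (1 : L) else 0)).Local v)) : Prop :=
  ∃ (θ₁ θ₃ : ↥(TorusDict.torus (IsCMField.complexConj L)) →ₜ* ℂˣ)
    (h₁ : TorusDict.IsAutomorphic (IsCMField.complexConj L) θ₁) (h₃ : TorusDict.IsAutomorphic (IsCMField.complexConj L) θ₃),
    θ₁ ≠ θ₃ ∧ ∀ᶠ v : HeightOneSpectrum (𝓞 ↥(maximalRealSubfield L)) in cofinite, IsThetaMemberAt L μω θ₁ θ₃ h₁ h₃ v (π₂ v)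

/-- Unfolding `IsThetaOfRecord` (`Iff.rfl`). [cite: Rogawski1990, §11.1 Prop. 11.1.1 (a) p. 162; §11.4 Prop. 11.4.1 (a) p. 166] -/
theorem isThetaOfRecord_iff (μω : HeckeCharacter L)
    (π₂ : ∀ v : HeightOneSpectrum (𝓞 ↥(maximalRealSubfield L)),
      IrrClass ((UnitaryGroup.cmDatum L 2 (Matrix.of fun i j : Fin 2 => if i.val + j.val + 1 = 2 then (1 : L) else 0)).Local v)) :
    IsThetaOfRecord L μω π₂ ↔
      ∃ (θ₁ θ₃ : ↥(TorusDict.torus (IsCMField.complexConj L)) →ₜ* ℂˣ)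
        (h₁ : TorusDict.IsAutomorphic (IsCMField.complexConj L) θ₁) (h₃ : TorusDict.IsAutomorphic (IsCMField.complexConj L) θ₃),
        θ₁ ≠ θ₃ ∧ ∀ᶠ v : HeightOneSpectrum (𝓞 ↥(maximalRealSubfield L)) in cofinite, IsThetaMemberAt L μω θ₁ θ₃ h₁ h₃ v (π₂ v) :=
  Iff.rfl

/-! ## §3 The reading for a DISCRETE automorphic representation of `U(Φ₂)` -/

/-- **`IsThetaOfRecordDiscrete μω ρ₁` — THE DISCRETE AUTOMORPHIC `ρ₁` OF `U(Φ₂)` IS OF THE FORM `ρ(θ)`, θ REGULAR** (the shape S10's H-family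
`d : J → DiscreteClass (cmDatum L 2 Φ₂) μH` and S7's `nH` law read): SOME family `π₂` of `v`-constituents of `ρ₁` at all but finitely many `v` (★ D6 constituent currency: the class
`IrrClass.comap (localPiEquiv v) (π₂ v)` is a constituent of the smooth part of `ρ₁|_{U(Φ₂)(𝔸_f)}` restricted along ★ `inclPlace v`) `IsThetaOfRecord`.  (Under an irreducible admissible
finite component all such families agree a.e., ★ `isConstituentOf_comp_inclPlace_subsingleton`, so «some» = «every».)
[cite: Rogawski1990, §11.1 p. 162; §11.5 p. 166; §13.3 p. 201] [cite: FlathCorvallis1979, Thm. 3] -/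
def IsThetaOfRecordDiscrete (μω : HeckeCharacter L)
    {μH : Measure (adelicGroupData (↥(maximalRealSubfield L)) L (IsCMField.complexConj L) 2
      (Matrix.of fun i j : Fin 2 => if i.val + j.val + 1 = 2 then (1 : L) else 0)).automorphicQuotient}
    [(adelicGroupData (↥(maximalRealSubfield L)) L (IsCMField.complexConj L) 2
      (Matrix.of fun i j : Fin 2 => if i.val + j.val + 1 = 2 then (1 : L) else 0)).IsAutomorphicMeasure μH]
    (ρ₁ : DiscreteAutomorphicRep (adelicGroupData (↥(maximalRealSubfield L)) L (IsCMField.complexConj L) 2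
      (Matrix.of fun i j : Fin 2 => if i.val + j.val + 1 = 2 then (1 : L) else 0)) μH) : Prop :=
  ∃ π₂ : ∀ v : HeightOneSpectrum (𝓞 ↥(maximalRealSubfield L)),
      IrrClass ((UnitaryGroup.cmDatum L 2 (Matrix.of fun i j : Fin 2 => if i.val + j.val + 1 = 2 then (1 : L) else 0)).Local v),
    (∀ᶠ v : HeightOneSpectrum (𝓞 ↥(maximalRealSubfield L)) in cofinite,
      (IrrClass.comap (localPiEquiv L (IsCMField.complexConj L) 2 (Matrix.of fun i j : Fin 2 => if i.val + j.val + 1 = 2 then (1 : L) else 0) v)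
          (π₂ v)).IsConstituentOf
        (ρ₁.finRep.smoothPart.toRepresentation.comp
          (inclPlace (↥(maximalRealSubfield L)) L (IsCMField.complexConj L) 2 (Matrix.of fun i j : Fin 2 => if i.val + j.val + 1 = 2 then (1 : L) else 0) v))) ∧
    IsThetaOfRecord L μω π₂

/-- Unfolding `IsThetaOfRecordDiscrete` (`Iff.rfl`). [cite: Rogawski1990, §11.1 p. 162; §13.3 p. 201] -/
theorem isThetaOfRecordDiscrete_iff (μω : HeckeCharacter L)
    {μH : Measure (adelicGroupData (↥(maximalRealSubfield L)) L (IsCMField.complexConj L) 2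
      (Matrix.of fun i j : Fin 2 => if i.val + j.val + 1 = 2 then (1 : L) else 0)).automorphicQuotient}
    [(adelicGroupData (↥(maximalRealSubfield L)) L (IsCMField.complexConj L) 2
      (Matrix.of fun i j : Fin 2 => if i.val + j.val + 1 = 2 then (1 : L) else 0)).IsAutomorphicMeasure μH]
    (ρ₁ : DiscreteAutomorphicRep (adelicGroupData (↥(maximalRealSubfield L)) L (IsCMField.complexConj L) 2
      (Matrix.of fun i j : Fin 2 => if i.val + j.val + 1 = 2 then (1 : L) else 0)) μH) :
    IsThetaOfRecordDiscrete L μω ρ₁ ↔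
      ∃ π₂ : ∀ v : HeightOneSpectrum (𝓞 ↥(maximalRealSubfield L)),
          IrrClass ((UnitaryGroup.cmDatum L 2 (Matrix.of fun i j : Fin 2 => if i.val + j.val + 1 = 2 then (1 : L) else 0)).Local v),
        (∀ᶠ v : HeightOneSpectrum (𝓞 ↥(maximalRealSubfield L)) in cofinite,
          (IrrClass.comap (localPiEquiv L (IsCMField.complexConj L) 2 (Matrix.of fun i j : Fin 2 => if i.val + j.val + 1 = 2 then (1 : L) else 0) v)
              (π₂ v)).IsConstituentOf
            (ρ₁.finRep.smoothPart.toRepresentation.comp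
              (inclPlace (↥(maximalRealSubfield L)) L (IsCMField.complexConj L) 2 (Matrix.of fun i j : Fin 2 => if i.val + j.val + 1 = 2 then (1 : L) else 0) v))) ∧
        IsThetaOfRecord L μω π₂ :=
  Iff.rfl

/-- NON-VACUITY ∕ SANITY: the predicates are genuine conditions on the DATA, not closed under every family — two families that agree at all but finitely many places are
simultaneously `IsThetaOfRecord` (the predicate only reads the cofinite germ of the family). [cite: Rogawski1990, §13.6 p. 209] -/
theorem IsThetaOfRecord.congr (μω : HeckeCharacter L)
    {π₂ π₂' : ∀ v : HeightOneSpectrum (𝓞 ↥(maximalRealSubfield L)),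
      IrrClass ((UnitaryGroup.cmDatum L 2 (Matrix.of fun i j : Fin 2 => if i.val + j.val + 1 = 2 then (1 : L) else 0)).Local v)}
    (h : IsThetaOfRecord L μω π₂) (hπ : ∀ᶠ v : HeightOneSpectrum (𝓞 ↥(maximalRealSubfield L)) in cofinite, π₂' v = π₂ v) :
    IsThetaOfRecord L μω π₂' := by
  obtain ⟨θ₁, θ₃, h₁, h₃, hne, hev⟩ := h
  refine ⟨θ₁, θ₃, h₁, h₃, hne, ?_⟩
  filter_upwards [hev, hπ] with v hv hv'
  rw [hv']
  exact hv

end Summit.HodgeConjecture.HodgeConjecture.R90.S5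

end
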